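import Literature.NumberTheory.LFunctions.ChebyshevHalfLineBiasVariants
import Literature.NumberTheory.LFunctions.ZetaScrewNonArchSign
import Literature.NumberTheory.LFunctions.ZetaScrewGrowthMomentsProofs
import HarnessLib

/-!
# RH-CONDITIONAL clause of an RH-EQUIVALENT criterion (Suzuki 2025, Thm 1, (i) ⇒ (iii)), PROVED — «nothing here bears on the truth of RH»
# `RH ⟹ Σ_{n ≤ x} Λ(n) n^{-1/2}(1 − log n/log x) − 4√x/log x → −(ζ'/ζ)(1/2)`: discharge of `Suzuki2025Chebyshev_thm1_i_imp_iii`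

LINE 1 — LABEL: RH-FREE literature (a kernel proof of the implication «RH ⟹ (1.6)»; the clause itself is
RH-CONDITIONAL, and together with the tree's `Suzuki2025_thm1` / `Suzuki2025_thm1_iii_imp` it completes the
RH-EQUIVALENCE (i) ⟺ (ii) ⟺ (iii) of the printed Theorem 1). bears_on: LADDER-RH COLUMN 1 SCREW (S-C, criterion rung;
the object is the tree's `zetaScrew = Ψ`). WHAT THIS IS NOT: not a route, not progress toward RH — an equivalence fixes
WHICH limit statement is RH, it does not move RH; nothing here bears on the truth of RH.

M. Suzuki, *On variants of Chebyshev's conjecture*, Ramanujan J. **68** (2025), no. 4, art. 95 = arXiv:2411.07436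
[`Suzuki2025Chebyshev`; PUBLISHED, refereed], **Theorem 1, (i) ⇒ (iii)** (§1.1), AS PRINTED: «(i) The RH holds. ⟹
(iii) `lim_{x→∞} [Σ_{n ≤ x} Λ(n) n^{-1/2} (1 − log n/log x) − 4√x/log x] = −(ζ'/ζ)(1/2)`», with
`−(ζ'/ζ)(1/2) = −½(γ + π/2 + 3 log 2 + log π)` ((3.2), the tree's `logDeriv_riemannZeta_one_half`). This is the named
fact `Suzuki2025Chebyshev_thm1_i_imp_iii` of `ChebyshevHalfLineBiasVariants.lean` (RH literature-typing tranche 1,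
p461476), DISCHARGED here: `Suzuki2025Chebyshev_thm1_i_imp_iii_holds`. Theorems only: no definitions, no named facts
(D-0014/D-0026).

## The printed proof (§3.1) and this formalisation (a shorter road through the tree — said once, here)

§3.1 derives (1.6) under RH from the explicit formula (3.1) ([So09]) for `Σ_{n ≤ x} Λ(n) n^{-1/2} log(x/n)`, whose sum
over the zeros is `O(√x)`-bounded under RH. The tree does not have (3.1) at `s = 1/2`; it has instead, for Suzuki's
screw function `Ψ = zetaScrew` ([Suzuki2023] (1.1)), the decomposition `Ψ = −g_0 − g_∞` of [Suzuki2025Chebyshev] (1.7)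
(`zetaScrew_eq_zetaScrewNonArch_sub_add`), the identity (1.9)
`−g_0(log x) = 4(√x + 1/√x − 2) − Σ_{n ≤ x} Λ(n) n^{-1/2} log(x/n)` (`zetaScrewNonArch_log`), and — the one input that
replaces (3.1) — **Suzuki 2023 Thm 1.6, `RH ⟹ Ψ = O(1)`** (`ZetaScrewGrowth.riemannHypothesis_iff_zetaScrew_bounded`,
PROVED in `ZetaScrewGrowthMomentsProofs.lean` from Thm 1.1 (2): `0 ≤ Ψ(t) = Σ_ρ m(ρ)(1 − cos γt)/γ² ≤ 2Σ_ρ m(ρ)/γ²`).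
Hence, for `x > 1`, with `κ = γ + π/2 + 3 log 2 + log π = 2(ζ'/ζ)(1/2)` and `C = Σ_{k ≥ 0}(k + 1/4)^{-2}`:

  `Σ_{n ≤ x} Λ(n) n^{-1/2}(1 − log n/log x) − 4√x/log x + κ/2`
  `= [4/√x − 8 − Ψ(log x) + ¼(C − x^{-1/2} Φ(x^{-2}, 2, 1/4))] / log x`      (`key_identity`)

and the numerator is bounded on `x > 1` under RH (`|4/√x| ≤ 4`, `|Ψ| ≤ M`, `0 ≤ x^{-1/2}Φ ≤ C`; `numerator_abs_le`), so
the left-hand side is `O(1/log x) → 0`. Deviation from print: the zero sum of (3.1) is replaced by the zero sum of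
[Suzuki2023] Thm 1.1 (2) packaged as Thm 1.6; no other input.

## References
* [Suzuki2025Chebyshev] M. Suzuki, Ramanujan J. 68 (2025) 95 = arXiv:2411.07436: Thm 1 (§1.1), (1.6), (1.7), (1.9),
  §3.1 (3.1)–(3.2).
* [Suzuki2023] M. Suzuki, J. Lond. Math. Soc. (2) 108 (2023) 1448–1487 = arXiv:2206.03682: (1.1), Thm 1.1 (2),
  Thm 1.6 (§7.1) — the tree's `ZetaScrew.lean`, `ZetaScrewThm17Proofs.lean`, `ZetaScrewGrowthMomentsProofs.lean`.
-/

noncomputable section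

open Filter Topology
open scoped Real ArithmeticFunction.vonMangoldt

namespace Literature.NumberTheory.LFunctions

namespace ChebyshevHalfLineBiasThm1

/-- **The key identity** (from (1.7) and (1.9)): for `x > 1`,
`Σ_{n ≤ x} Λ(n) n^{-1/2}(1 − log n/log x) − 4√x/log x + κ/2 = [4/√x − 8 − Ψ(log x) + ¼(C − x^{-1/2}Φ)]/log x`,
`κ = γ + π/2 + 3 log 2 + log π`, `C = Σ_{k ≥ 0}(k + 1/4)^{-2}`, `Φ = hurwitzLerchQuarter (log x)`.
[cite: Suzuki2025Chebyshev, §1.1 eq. (1.7) and (1.9)] -/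
theorem key_identity {x : ℝ} (hx : 1 < x) :
    (∑ n ∈ Finset.Icc 1 ⌊x⌋₊, Λ n / Real.sqrt n * (1 - Real.log n / Real.log x)
        - 4 * Real.sqrt x / Real.log x)
      + (Real.eulerMascheroniConstant + Real.pi / 2 + 3 * Real.log 2 + Real.log Real.pi) / 2 =
    (4 / Real.sqrt x - 8 - zetaScrew (Real.log x)
      + (1 / 4) * ((∑' k : ℕ, 1 / ((k : ℝ) + 1 / 4) ^ 2)
          - Real.exp (-(Real.log x / 2)) * hurwitzLerchQuarter (Real.log x))) / Real.log x := by
  have hx0 : 0 < x := by linarith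
  have hL : 0 < Real.log x := Real.log_pos hx
  -- `E(x) · log x = Σ_{n ≤ x} Λ(n) n^{-1/2} log(x/n) − 4√x` (as in the tree's `Suzuki2025_thm1_iii_imp`)
  have hsum : (∑ n ∈ Finset.Icc 1 ⌊x⌋₊, Λ n / Real.sqrt n * (1 - Real.log n / Real.log x)
      - 4 * Real.sqrt x / Real.log x) * Real.log x =
      ∑ n ∈ Finset.Icc 1 ⌊x⌋₊, Λ n / Real.sqrt n * Real.log (x / n) - 4 * Real.sqrt x := by
    rw [sub_mul, Finset.sum_mul, div_mul_cancel₀ _ hL.ne']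
    congr 1
    refine Finset.sum_congr rfl fun n hn ↦ ?_
    have hn1 : 1 ≤ n := (Finset.mem_Icc.1 hn).1
    rw [Real.log_div hx0.ne' (by exact_mod_cast (show n ≠ 0 by omega))]
    field_simp
  -- (1.9): `−g_0(log x) = 4(√x + 1/√x − 2) − Σ_{n ≤ x} Λ(n) n^{-1/2} log(x/n)`
  have hN := zetaScrewNonArch_log hx.le
  -- (1.7): `Ψ = −g_0 − (|t|/2)κ + ¼(C − e^{−|t|/2}Φ)` at `t = log x > 0`
  have hΨ := zetaScrew_eq_zetaScrewNonArch_sub_add (Real.log x)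
  rw [abs_of_pos hL] at hΨ
  rw [eq_div_iff hL.ne', add_mul, hsum]
  linear_combination hΨ + hN

/-- **The numerator is bounded under RH**: if `|Ψ(t)| ≤ M` for `t ≥ 0`, then for `x > 1`
`|4/√x − 8 − Ψ(log x) + ¼(C − x^{-1/2}Φ)| ≤ 12 + M + C/4` (`|4/√x| ≤ 4`, `0 ≤ e^{−t/2}Φ_t ≤ Φ_t ≤ C` by the tree's
`hurwitzLerchQuarter_nonneg` / `hurwitzLerchQuarter_le`). [cite: Suzuki2025Chebyshev, §3.1 (proof of Thm 1)] -/
theorem numerator_abs_le {M : ℝ} (hM : ∀ t : ℝ, 0 ≤ t → |zetaScrew t| ≤ M) {x : ℝ} (hx : 1 < x) :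
    |4 / Real.sqrt x - 8 - zetaScrew (Real.log x)
      + (1 / 4) * ((∑' k : ℕ, 1 / ((k : ℝ) + 1 / 4) ^ 2)
          - Real.exp (-(Real.log x / 2)) * hurwitzLerchQuarter (Real.log x))|
      ≤ 12 + M + (∑' k : ℕ, 1 / ((k : ℝ) + 1 / 4) ^ 2) / 4 := by
  have hx0 : 0 < x := by linarith
  have hL0 : 0 ≤ Real.log x := (Real.log_pos hx).le
  have hC0 : 0 ≤ ∑' k : ℕ, 1 / ((k : ℝ) + 1 / 4) ^ 2 := tsum_nonneg fun k ↦ by positivity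
  have hs1 : 1 ≤ Real.sqrt x := by
    rw [← Real.sqrt_one]
    exact Real.sqrt_le_sqrt hx.le
  have hs0 : 0 < Real.sqrt x := by linarith
  have h1 : 4 / Real.sqrt x ≤ 4 := by
    rw [div_le_iff₀ hs0]
    nlinarith
  have h1' : 0 ≤ 4 / Real.sqrt x := by positivity
  have h2 := abs_le.1 (hM _ hL0)
  have hΦ0 := hurwitzLerchQuarter_nonneg (Real.log x)
  have hΦC := hurwitzLerchQuarter_le (Real.log x)
  have hE1 : Real.exp (-(Real.log x / 2)) ≤ 1 := by
    rw [Real.exp_le_one_iff]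
    linarith
  have h3 : 0 ≤ Real.exp (-(Real.log x / 2)) * hurwitzLerchQuarter (Real.log x) :=
    mul_nonneg (Real.exp_pos _).le hΦ0
  have h4 : Real.exp (-(Real.log x / 2)) * hurwitzLerchQuarter (Real.log x) ≤
      ∑' k : ℕ, 1 / ((k : ℝ) + 1 / 4) ^ 2 :=
    le_trans (mul_le_of_le_one_left hΦ0 hE1) hΦC
  rw [abs_le]
  constructor <;> linarith

/-- **The eventual bound**: if `|Ψ(t)| ≤ M` for `t ≥ 0`, then for `x > 1`
`|Σ_{n ≤ x} Λ(n) n^{-1/2}(1 − log n/log x) − 4√x/log x + κ/2| ≤ (12 + M + C/4)/log x`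
(`key_identity` and `numerator_abs_le`). [cite: Suzuki2025Chebyshev, §3.1 (proof of Thm 1)] -/
theorem norm_sub_le {M : ℝ} (hM : ∀ t : ℝ, 0 ≤ t → |zetaScrew t| ≤ M) {x : ℝ} (hx : 1 < x) :
    ‖(∑ n ∈ Finset.Icc 1 ⌊x⌋₊, Λ n / Real.sqrt n * (1 - Real.log n / Real.log x)
        - 4 * Real.sqrt x / Real.log x)
      - -((Real.eulerMascheroniConstant + Real.pi / 2 + 3 * Real.log 2 + Real.log Real.pi) / 2)‖ ≤
      (12 + M + (∑' k : ℕ, 1 / ((k : ℝ) + 1 / 4) ^ 2) / 4) * (Real.log x)⁻¹ := by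
  have hL : 0 < Real.log x := Real.log_pos hx
  rw [sub_neg_eq_add, key_identity hx, Real.norm_eq_abs, abs_div, abs_of_pos hL, div_eq_mul_inv]
  exact mul_le_mul_of_nonneg_right (numerator_abs_le hM hx) (inv_nonneg.2 hL.le)

/-- `K/log x → 0` as `x → ∞` (private plumbing). [folklore] -/
private theorem tendsto_const_mul_inv_log (K : ℝ) :
    Tendsto (fun x : ℝ ↦ K * (Real.log x)⁻¹) atTop (𝓝 0) := by
  have h := (tendsto_inv_atTop_zero.comp Real.tendsto_log_atTop).const_mul K
  rw [mul_zero] at h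
  exact h

end ChebyshevHalfLineBiasThm1

open ChebyshevHalfLineBiasThm1 in
/-- **Suzuki 2025, Theorem 1, (i) ⇒ (iii)** — discharge of the named fact `Suzuki2025Chebyshev_thm1_i_imp_iii`:
under RH, `Σ_{n ≤ x} Λ(n) n^{-1/2}(1 − log n/log x) − 4√x/log x → −½(γ + π/2 + 3 log 2 + log π) = −(ζ'/ζ)(1/2)` as
`x → ∞`. Proof: `key_identity` + `numerator_abs_le` with the bound `M` of Suzuki 2023 Thm 1.6 (`RH ⟹ Ψ = O(1)`, the
tree's `ZetaScrewGrowth.riemannHypothesis_iff_zetaScrew_bounded`), and `1/log x → 0`. RH-CONDITIONAL clause of an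
RH-EQUIVALENT criterion; RH-FREE proof. [cite: Suzuki2025Chebyshev, Thm 1 ((i) ⇒ (iii)) and §3.1 eq. (3.1)–(3.2)] -/
theorem Suzuki2025Chebyshev_thm1_i_imp_iii_holds : Suzuki2025Chebyshev_thm1_i_imp_iii := by
  intro hRH
  obtain ⟨M, hM⟩ := ZetaScrewGrowth.riemannHypothesis_iff_zetaScrew_bounded.1 hRH
  rw [← tendsto_sub_nhds_zero_iff]
  refine squeeze_zero_norm' ?_
    (tendsto_const_mul_inv_log (12 + M + (∑' k : ℕ, 1 / ((k : ℝ) + 1 / 4) ^ 2) / 4))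
  filter_upwards [eventually_gt_atTop (1 : ℝ)] with x hx
  exact norm_sub_le hM hx

end Literature.NumberTheory.LFunctions

end
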